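import Literature.Probability.RandomPlanarGeometry.SLELawTransport
import Literature.Probability.RandomPlanarGeometry.SLEExistenceNeEightHolds
import HarnessLib

/-!
# The image of the SLE_κ trace under a continuous map of the closed half-plane, as a random curve

Topic `Probability/RandomPlanarGeometry`; theorems only (no definition, no named fact).

`SLELawTransport.exists_isSLECurve_through` builds, for a chordal uniformizing map `φ : ℍ → D` of
a Dobrushin domain, an a.e.-measurable random curve class `Γ` which is almost surely the class of
the time-compactified image `s ↦ Φ (γ (s / (1 - s)))`, `1 ↦ b`, of the SLE_κ trace `γ` under the
boundary extension `Φ = φ.boundaryExtension` (Lawler (2005), §6.3: "chordal SLE_κ in `(D; a, b)`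
is the image of the half-plane SLE_κ under a conformal map `ℍ → D`, `0 ↦ a`, `∞ ↦ b`"). That
construction uses about `Φ` only two facts: `Φ` is continuous on the closed half-plane `ℍ̄`, and
`Φ → b` at infinity within `ℍ̄`. This file runs the same construction for an ARBITRARY map
`ψ : ℂ → ℂ` with these two properties (`exists_curveClass_image_sleTrace`), which is the form
needed for the domain Markov property of chordal SLE: there the relevant map is
`ψ = Φ_D ∘ F_τ (· + W_τ)` (`F_τ` the continuous extension of the inverse Loewner map `g_τ⁻¹`),
continuous on `ℍ̄` with limit `b` at infinity, but not the boundary extension of a uniformizing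
map of a Jordan domain.

* `IsCompactifiedImage.curve_eq` — the compactified image curve is unique (its values are
  prescribed at every `s < 1` and at `s = 1`); hence two random curve classes which are a.s. the
  class of the compactified image agree a.e. (`ae_eq_of_isCompactifiedImage_sleTrace`) and have
  the same law (`map_eq_of_isCompactifiedImage_sleTrace`);
* `exists_curveClass_image_sleTrace_of_transient` — the construction at one `κ`, from generation
  by a curve, a.s. transience of the trace and a.e.-measurability of its marginals;
* `exists_curveClass_image_sleTrace` — the same with the global transience fact
  `tendsto_norm_sleTrace_atTop` (Rohde–Schramm (2005), Thm. 7.1) as hypothesis, exactly as in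
  `exists_isSLECurve_through`;
* `exists_curveClass_image_sleTrace_of_ne_eight`, `exists_curveClass_image_sleTrace_six` — the
  hypothesis-free statements for `0 < κ ≠ 8` (Rohde–Schramm's Thm. 5.1
  `hasSLETrace_of_ne_eight_apply`, Thm. 7.1 `tendsto_norm_sleTrace_atTop_of_ne_eight`, and the
  measurability of the trace marginals `aemeasurable_sleTrace_holds`, all theorems of the tree).

Not here: any identification of the law of `Γ` (for `ψ` a boundary extension of a chordal
uniformizing map this is `IsSLECurve.of_through` / `IsSLELaw.exists_eq_map_through`).

## References

* G. F. Lawler, *Conformally Invariant Processes in the Plane*, AMS (2005), §6.3.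
* S. Rohde, O. Schramm, *Basic properties of SLE*, Ann. of Math. 161 (2005), Thm. 5.1, Thm. 7.1.
-/

noncomputable section

open Set Filter Topology MeasureTheory Complex
open UpperHalfPlane (upperHalfPlaneSet)
open scoped NNReal unitInterval

namespace Literature.Probability.RandomPlanarGeometry

variable {κ : ℝ≥0}

/-! ### Uniqueness of the compactified image -/

/-- **The compactified image curve is unique**: `IsCompactifiedImage ψ γ b c` prescribes the value
of `c` at every `s < 1` (`ψ (γ (s / (1 - s)))`) and at `s = 1` (`b`), so two such curves are
equal. [folklore] -/
theorem IsCompactifiedImage.curve_eq {ψ : ℂ → ℂ} {γ : ℝ≥0 → ℂ} {b : ℂ} {c c' : Curve ℂ}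
    (h : IsCompactifiedImage ψ γ b c) (h' : IsCompactifiedImage ψ γ b c') : c = c' :=
  DFunLike.ext c c' fun s ↦ by rw [← h.nodeValue_eq s, h'.nodeValue_eq s]

/-- Two compactified image curves of the same path under the same map define the same curve
class. [folklore] -/
theorem IsCompactifiedImage.curveClassMk_eq {ψ : ℂ → ℂ} {γ : ℝ≥0 → ℂ} {b : ℂ} {c c' : Curve ℂ}
    (h : IsCompactifiedImage ψ γ b c) (h' : IsCompactifiedImage ψ γ b c') :
    CurveClass.mk c = CurveClass.mk c' := by
  rw [h.curve_eq h']

/-- **A.e. uniqueness of the image curve class.** Two random curve classes which are almost surely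
the class of the compactified image of the SLE_κ trace under `ψ` (endpoint `b`) agree almost
everywhere. [folklore] -/
theorem ae_eq_of_isCompactifiedImage_sleTrace {ψ : ℂ → ℂ} {b : ℂ}
    {Γ Γ' : (ℝ≥0 → ℝ) → CurveClass ℂ}
    (hΓ : ∀ᵐ ω ∂Process.preWienerMeasure,
      ∃ c : Curve ℂ, Γ ω = CurveClass.mk c ∧ IsCompactifiedImage ψ (sleTrace κ ω) b c)
    (hΓ' : ∀ᵐ ω ∂Process.preWienerMeasure,
      ∃ c : Curve ℂ, Γ' ω = CurveClass.mk c ∧ IsCompactifiedImage ψ (sleTrace κ ω) b c) :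
    Γ =ᵐ[Process.preWienerMeasure] Γ' := by
  filter_upwards [hΓ, hΓ'] with ω h h'
  obtain ⟨c, hc, hI⟩ := h
  obtain ⟨c', hc', hI'⟩ := h'
  rw [hc, hc', hI.curve_eq hI']

/-- **Uniqueness in law of the image curve class.** Two random curve classes which are almost
surely the class of the compactified image of the SLE_κ trace under `ψ` (endpoint `b`) have the
same law (`Measure.map_congr`). [folklore] -/
theorem map_eq_of_isCompactifiedImage_sleTrace {ψ : ℂ → ℂ} {b : ℂ}
    {Γ Γ' : (ℝ≥0 → ℝ) → CurveClass ℂ}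
    (hΓ : ∀ᵐ ω ∂Process.preWienerMeasure,
      ∃ c : Curve ℂ, Γ ω = CurveClass.mk c ∧ IsCompactifiedImage ψ (sleTrace κ ω) b c)
    (hΓ' : ∀ᵐ ω ∂Process.preWienerMeasure,
      ∃ c : Curve ℂ, Γ' ω = CurveClass.mk c ∧ IsCompactifiedImage ψ (sleTrace κ ω) b c) :
    Process.preWienerMeasure.map Γ = Process.preWienerMeasure.map Γ' :=
  Measure.map_congr (ae_eq_of_isCompactifiedImage_sleTrace hΓ hΓ')

/-- Uniqueness in law of the image curve class, for the almost-sure description produced by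
`exists_curveClass_image_sleTrace` (generation by the trace AND the compactified image). [folklore] -/
theorem map_eq_of_isCompactifiedImage_sleTrace' {ψ : ℂ → ℂ} {b : ℂ}
    {Γ Γ' : (ℝ≥0 → ℝ) → CurveClass ℂ}
    (hΓ : ∀ᵐ ω ∂Process.preWienerMeasure, Loewner.IsGeneratedByCurve (sleDriving κ ω) (sleTrace κ ω) ∧
      ∃ c : Curve ℂ, Γ ω = CurveClass.mk c ∧ IsCompactifiedImage ψ (sleTrace κ ω) b c)
    (hΓ' : ∀ᵐ ω ∂Process.preWienerMeasure, Loewner.IsGeneratedByCurve (sleDriving κ ω) (sleTrace κ ω) ∧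
      ∃ c : Curve ℂ, Γ' ω = CurveClass.mk c ∧ IsCompactifiedImage ψ (sleTrace κ ω) b c) :
    Process.preWienerMeasure.map Γ = Process.preWienerMeasure.map Γ' :=
  map_eq_of_isCompactifiedImage_sleTrace (hΓ.mono fun _ h ↦ h.2) (hΓ'.mono fun _ h ↦ h.2)

/-! ### The image curve -/

/-- **The image of the SLE_κ trace under a continuous map of the closed half-plane, at one `κ`.**
If SLE_κ is generated by a curve (`hκt`), its trace `γ` is a.s. transient (`htr`) with
a.e.-measurable marginals (`hmeas`), and `ψ : ℂ → ℂ` is continuous on the closed half-plane with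
`ψ → b` at infinity within it, then there is an a.e.-measurable random curve class `Γ` which is
almost surely the class of the time-compactified image `s ↦ ψ (γ (s / (1 - s)))`, `1 ↦ b`, of the
trace. The construction is that of `exists_isSLECurve_through` (Lawler (2005), §6.3, for `ψ` the
boundary extension of a uniformizing map), verbatim: on a measurable set of full measure where the
chain is generated by the transient trace `γ`, agreeing at the countably many compactified rational
times with measurable modifications of its marginals, `Γ ω` is the class of the continuous curve
`nodeValue ψ b γ` (`continuous_nodeValue`), measurable by `measurable_curveClassMk`; elsewhere the
constant curve `b`. [cite: Lawler2005, §6.3] -/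
theorem exists_curveClass_image_sleTrace_of_transient (hκt : HasSLETrace κ)
    (htr : ∀ᵐ ω ∂Process.preWienerMeasure, Tendsto (fun t ↦ ‖sleTrace κ ω t‖) atTop atTop)
    (hmeas : ∀ t : ℝ≥0, AEMeasurable (fun ω ↦ sleTrace κ ω t) Process.preWienerMeasure)
    {ψ : ℂ → ℂ} {b : ℂ} (hψ : ContinuousOn ψ (closure upperHalfPlaneSet))
    (hψb : Tendsto ψ (cocompact ℂ ⊓ 𝓟 (closure upperHalfPlaneSet)) (𝓝 b)) :
    ∃ Γ : (ℝ≥0 → ℝ) → CurveClass ℂ, AEMeasurable Γ Process.preWienerMeasure ∧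
      ∀ᵐ ω ∂Process.preWienerMeasure, Loewner.IsGeneratedByCurve (sleDriving κ ω) (sleTrace κ ω) ∧
        ∃ c : Curve ℂ, Γ ω = CurveClass.mk c ∧ IsCompactifiedImage ψ (sleTrace κ ω) b c := by
  -- adapted from `exists_isSLECurve_through` (`SLELawTransport`), with `Φ := ψ`
  classical
  set γ : (ℝ≥0 → ℝ) → ℝ≥0 → ℂ := fun ω ↦ sleTrace κ ω with hγdef
  -- a countable dense set of parameters and measurable modifications of the marginals there
  obtain ⟨S, hSc, hSd⟩ := TopologicalSpace.exists_countable_dense I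
  haveI : Countable S := hSc.to_subtype
  have hm : ∀ s : S, AEMeasurable (fun ω ↦ γ ω (rayParam s)) Process.preWienerMeasure :=
    fun s ↦ hmeas (rayParam s)
  set g : S → (ℝ≥0 → ℝ) → ℂ := fun s ↦ (hm s).mk _ with hgdef
  have hgm : ∀ s, Measurable (g s) := fun s ↦ (hm s).measurable_mk
  -- the good event, of full measure
  set G : Set (ℝ≥0 → ℝ) := {ω | Loewner.IsGeneratedByCurve (sleDriving κ ω) (γ ω) ∧
    Tendsto (fun t ↦ ‖γ ω t‖) atTop atTop ∧ ∀ s : S, γ ω (rayParam s) = g s ω} with hGdef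
  have hG : ∀ᵐ ω ∂Process.preWienerMeasure, ω ∈ G := by
    have h3 : ∀ᵐ ω ∂Process.preWienerMeasure, ∀ s : S, γ ω (rayParam s) = g s ω :=
      ae_all_iff.2 fun s ↦ (hm s).ae_eq_mk
    filter_upwards [ae_isGeneratedByCurve_sleTrace hκt, htr, h3] with ω h1 h2 h3
    exact ⟨h1, h2, h3⟩
  obtain ⟨N, hGN, hNm, hN0⟩ := exists_measurable_superset_of_null (ae_iff.1 hG)
  have hgood : ∀ ω, ω ∈ Nᶜ → ω ∈ G := fun ω hω ↦ by
    by_contra hωG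
    exact hω (hGN hωG)
  have hae : ∀ᵐ ω ∂Process.preWienerMeasure, ω ∈ Nᶜ := measure_eq_zero_iff_ae_notMem.1 hN0
  -- the curve on the good event
  have hcurve : ∀ ω, ω ∈ Nᶜ → Continuous (nodeValue ψ b (γ ω)) := fun ω hω ↦
    continuous_nodeValue hψ hψb (hgood ω hω).1.continuous
      (fun t ↦ sleTrace_mem_closure κ ω t) (tendsto_cocompact_of_tendsto_norm_atTop (hgood ω hω).2.1)
  set f : (Nᶜ : Set (ℝ≥0 → ℝ)) → CurveClass ℂ :=
    fun ω ↦ CurveClass.mk ⟨⟨nodeValue ψ b (γ ω), hcurve ω ω.2⟩⟩ with hfdef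
  -- measurability of `f` on the good event
  have hf : Measurable f := by
    refine measurable_curveClassMk (fun ω : (Nᶜ : Set (ℝ≥0 → ℝ)) ↦ hcurve ω ω.2) hSc hSd ?_
    intro s hs
    by_cases hs1 : (s : ℝ) < 1
    · have hψr : Continuous ((closure upperHalfPlaneSet).restrict ψ) :=
        continuousOn_iff_continuous_restrict.1 hψ
      have hgs : Measurable fun ω : (Nᶜ : Set (ℝ≥0 → ℝ)) ↦
          (⟨γ ω (rayParam s), sleTrace_mem_closure κ ω _⟩ : closure upperHalfPlaneSet) := by
        refine Measurable.subtype_mk ?_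
        have heq : (fun ω : (Nᶜ : Set (ℝ≥0 → ℝ)) ↦ γ ω (rayParam s)) =
            fun ω : (Nᶜ : Set (ℝ≥0 → ℝ)) ↦ g ⟨s, hs⟩ ω :=
          funext fun ω ↦ (hgood ω ω.2).2.2 ⟨s, hs⟩
        rw [heq]
        exact (hgm ⟨s, hs⟩).comp measurable_subtype_coe
      have heq : (fun ω : (Nᶜ : Set (ℝ≥0 → ℝ)) ↦ nodeValue ψ b (γ ω) s) =
          fun ω : (Nᶜ : Set (ℝ≥0 → ℝ)) ↦ (closure upperHalfPlaneSet).restrict ψ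
            ⟨γ ω (rayParam s), sleTrace_mem_closure κ ω _⟩ :=
        funext fun ω ↦ nodeValue_of_lt ψ b (γ ω) hs1
      rw [heq]
      exact hψr.measurable.comp hgs
    · obtain rfl : s = 1 := Subtype.ext (le_antisymm s.2.2 (not_lt.1 hs1))
      simp only [nodeValue_one]
      exact measurable_const
  -- the random curve
  refine ⟨fun ω ↦ if hω : ω ∈ Nᶜ then f ⟨ω, hω⟩ else CurveClass.mk (Curve.const b), ?_, ?_⟩
  · exact (Measurable.dite hf measurable_const hNm.compl).aemeasurable
  · filter_upwards [hae] with ω hω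
    refine ⟨(hgood ω hω).1, ⟨⟨nodeValue ψ b (γ ω), hcurve ω hω⟩⟩, ?_, ?_, ?_⟩
    · simp only [dif_pos hω, hfdef]
    · intro s hs
      exact nodeValue_of_lt ψ b (γ ω) hs
    · exact nodeValue_one ψ b (γ ω)

/-- **The image of the SLE_κ trace under a continuous map of the closed half-plane, as a random
curve class.** If SLE_κ (`κ > 0`) has a trace, the trace is transient (the fact
`tendsto_norm_sleTrace_atTop`, Rohde–Schramm (2005), Thm. 7.1) with a.e.-measurable marginals,
and `ψ : ℂ → ℂ` is continuous on the closed half-plane with `ψ → b` at infinity within it, then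
there is an a.e.-measurable random curve class `Γ` which is almost surely the class of the
time-compactified image `s ↦ ψ (γ (s / (1 - s)))`, `1 ↦ b`, of the SLE_κ trace `γ`. This is
`exists_isSLECurve_through` (Lawler (2005), §6.3) with the boundary extension of a chordal
uniformizing map replaced by any such `ψ`. [cite: Lawler2005, §6.3] -/
theorem exists_curveClass_image_sleTrace {κ : ℝ≥0} (hκt : HasSLETrace κ) (hκ : 0 < κ)
    (htr : tendsto_norm_sleTrace_atTop)
    (hmeas : ∀ t : ℝ≥0, AEMeasurable (fun ω ↦ sleTrace κ ω t) Process.preWienerMeasure)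
    {ψ : ℂ → ℂ} {b : ℂ} (hψ : ContinuousOn ψ (closure upperHalfPlaneSet))
    (hψb : Tendsto ψ (cocompact ℂ ⊓ 𝓟 (closure upperHalfPlaneSet)) (𝓝 b)) :
    ∃ Γ : (ℝ≥0 → ℝ) → CurveClass ℂ, AEMeasurable Γ Process.preWienerMeasure ∧
      ∀ᵐ ω ∂Process.preWienerMeasure, Loewner.IsGeneratedByCurve (sleDriving κ ω) (sleTrace κ ω) ∧
        ∃ c : Curve ℂ, Γ ω = CurveClass.mk c ∧ IsCompactifiedImage ψ (sleTrace κ ω) b c :=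
  exists_curveClass_image_sleTrace_of_transient hκt (htr hκ) hmeas hψ hψb

/-! ### Hypothesis-free statements for `κ ≠ 8` -/

/-- **The image of the SLE_κ trace under a continuous map of the closed half-plane, for
`0 < κ ≠ 8`, unconditionally**: generation by a curve is Rohde–Schramm's Thm. 5.1
(`hasSLETrace_of_ne_eight_apply`), transience their Thm. 7.1
(`tendsto_norm_sleTrace_atTop_of_ne_eight`), measurability of the trace marginals is
`aemeasurable_sleTrace_holds`. [cite: RohdeSchramm2005, Thm 5.1 and Thm 7.1] -/
theorem exists_curveClass_image_sleTrace_of_ne_eight (hκ0 : 0 < κ) (hκ8 : κ ≠ 8)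
    {ψ : ℂ → ℂ} {b : ℂ} (hψ : ContinuousOn ψ (closure upperHalfPlaneSet))
    (hψb : Tendsto ψ (cocompact ℂ ⊓ 𝓟 (closure upperHalfPlaneSet)) (𝓝 b)) :
    ∃ Γ : (ℝ≥0 → ℝ) → CurveClass ℂ, AEMeasurable Γ Process.preWienerMeasure ∧
      ∀ᵐ ω ∂Process.preWienerMeasure, Loewner.IsGeneratedByCurve (sleDriving κ ω) (sleTrace κ ω) ∧
        ∃ c : Curve ℂ, Γ ω = CurveClass.mk c ∧ IsCompactifiedImage ψ (sleTrace κ ω) b c :=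
  exists_curveClass_image_sleTrace_of_transient (hasSLETrace_of_ne_eight_apply hκ8)
    (tendsto_norm_sleTrace_atTop_of_ne_eight hκ0 hκ8)
    (aemeasurable_sleTrace_holds (hasSLETrace_of_ne_eight_apply hκ8)) hψ hψb

/-- **The image of the SLE₆ trace under a continuous map of the closed half-plane** (the case of
critical percolation interfaces), unconditionally. [cite: RohdeSchramm2005, Thm 5.1 and Thm 7.1] -/
theorem exists_curveClass_image_sleTrace_six
    {ψ : ℂ → ℂ} {b : ℂ} (hψ : ContinuousOn ψ (closure upperHalfPlaneSet))
    (hψb : Tendsto ψ (cocompact ℂ ⊓ 𝓟 (closure upperHalfPlaneSet)) (𝓝 b)) :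
    ∃ Γ : (ℝ≥0 → ℝ) → CurveClass ℂ, AEMeasurable Γ Process.preWienerMeasure ∧
      ∀ᵐ ω ∂Process.preWienerMeasure, Loewner.IsGeneratedByCurve (sleDriving 6 ω) (sleTrace 6 ω) ∧
        ∃ c : Curve ℂ, Γ ω = CurveClass.mk c ∧ IsCompactifiedImage ψ (sleTrace 6 ω) b c :=
  exists_curveClass_image_sleTrace_of_ne_eight (by norm_num) (by norm_num) hψ hψb

end Literature.Probability.RandomPlanarGeometry

end
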